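/-
Copyright (c) 2026 the pub-hodgecm-mathlib formalisation cell (harness21).  Prover seat hodgecm-mathlib-K2E2-p12 (g5): Track B «K2-LIT», ENGINE E1,
h413 = stmt-HodgeConjecture-24833; «EIS-WHITTAKER-3» W3₃ (W-asm) sub-brick (U3C-c3-unif) «THE UNIT VALUES OFF A ξ-INDEPENDENT FINITE SET» (dealer K2E1-plan (g6) ruling (8)(Qc)
«K2E2-p12 instantiates»: the `hW` clause of ★ F3 `K2E1WhittakerContinuationConcreteU3` (K2E1-p10) in its own shape).
-/
import Summits.HodgeConjecture.HodgeConjecture.Theorems.K2E1WhittakerLocalUnitValuesCofiniteU3   -- ★ (this seat) (U3C-c3): `one_add_delta_ne_zero`, `mul_complexConj_mem` (+ c3-inert ∕ c3-split)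
import HarnessLib

/-!
# K2·E1 — `K2E1WhittakerLocalUnitValuesUniformU3` («EIS-WHITTAKER-3» W3₃, (W-asm) sub-brick (U3C-c3-unif)): A ξ-INDEPENDENT FINITE SET `S_*` OFF WHICH ★ B1's LOCAL WHITTAKER
# TOKEN TAKES ITS UNIT VALUE AT EVERY `ξ` THAT IS A UNIT ABOVE `v` — the `hW` clause of ★ F3 `exists_whittaker_letters_cm_three_of` (K2E1-p10) VERBATIM

Track B ∕ K2-LIT, crux h413 = `stmt-HodgeConjecture-24833`, route of record `HCCMUnconditional`; cell `hodgecm-mathlib`, squad K2, ENGINE E1 (campaign «EIS-WHITTAKER-3», rung W3₃).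
THEOREMS ONLY (no `def`, no instance, no notation, no `sorry`; default heartbeats); lane `--supports stmt-HodgeConjecture-24833 --as helper` (count-neutral).  Same assembly as
★ `eventually_localWhittaker_eq_unit` (★ (U3C-c3)), but with the exceptional set made INDEPENDENT of `ξ`: `S_* =` ramified `v` ∪ `v ∣ 2` ∪ non-unit places of `δ, d, 1 ± δ` ∪ places where
some `χ_w` (`w ∣ v`) has non-zero conductor; off `S_*`, «`ξ` a unit at every `w ∣ v`» (★ F3's hypothesis `∀ w', w'.1.valuation L ξ = 1`) implies that `ξ·cξ`, `cξ(1+δ)` and `ξ(1−δ)` are units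
above `v` (Galois transport ★ `valued_galAdicCompletionMap`), whence ★ (U3C-c3-inert) ∕ ★ (U3C-c3-split) apply.
* `valued_complexConj_eq_one`, **`exists_finset_forall_localWhittaker_eq_unit`** (HEAD): `∃ S_* : Finset, ∀ v ∉ S_*, ∀ ξ : L, (∀ w' ∣ v, w'.valuation ξ = 1) → ∀ z, 1 < Re z →
  W_v(ξ,z) = (1 − q_v^{−z})(1 − ε_v q_v^{−z})(1 − ε_v q_v^{−(2z−1)})` — ★ B1's token, ★ F3's `hW` clause VERBATIM for every `S₀ ⊇ S_*`.
HONEST LABEL: HC_CM is proved only modulo the 7 printed citations (2 remaining named inputs: hLiu418 = `stmt-HodgeConjecture-24832`, h413 = `stmt-HodgeConjecture-24833`) until rung 0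
closes; this file asserts no named fact and closes no socket; count-neutral; unconditional.

## References
* [Rogawski1990] J. D. Rogawski, *Automorphic Representations of Unitary Groups in Three Variables* (1990): §4.5.
* [Langlands1971] R. P. Langlands, *Euler Products* (1971): §3.
* [CasselsFrohlichANT1967] J. W. S. Cassels, A. Fröhlich (eds.), *Algebraic Number Theory* (1967): Ch. VII §1.1 (Galois action on completions).
-/

set_option autoImplicit false
set_option linter.dupNamespace false -- the mandated namespace repeats `HodgeConjecture.HodgeConjecture`

noncomputable section

open MeasureTheory NumberField IsDedekindDomain Filter
open scoped NNReal ENNReal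
open Literature.NumberTheory.Automorphic Literature.NumberTheory.Automorphic.UnitaryGroup Literature.NumberTheory.GaloisRepresentations
open Literature.NumberTheory.GaloisRepresentations.IsNonarchimedeanLocalField
open Literature.NumberTheory.GelbartRogawski1991.UnitaryDualPair.LocalSplitting (splitSqrt toPlace_surjective valued_toPlace_of_split valued_splitSqrt)
open Summit.HodgeConjecture.HodgeConjecture.Cruxes.H413.K2E1IntertwiningLocalFactorU3HeightSplit (smul_galInv_ne)
open Summit.HodgeConjecture.HodgeConjecture.Cruxes.H413.K2E1WhittakerLocalCharactersCM (eventually_hasConductorExp_zero_charComp)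
open Summit.HodgeConjecture.HodgeConjecture.Cruxes.H413.K2E1WhittakerLocalRotationU3 (normAbs_eq_one_of_valued_eq_one)
open Summit.HodgeConjecture.HodgeConjecture.Cruxes.H413.K2E1WhittakerLocalUnitValueInertU3 (localWhittaker_eq_unit_of_nonsplit)
open Summit.HodgeConjecture.HodgeConjecture.Cruxes.H413.K2E1WhittakerLocalUnitValueSplitU3 (localWhittaker_eq_unit_of_split)
open Summit.HodgeConjecture.HodgeConjecture.Cruxes.H413.K2E1WhittakerLocalUnitValuesCofiniteU3 (one_add_delta_ne_zero mul_complexConj_mem)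

namespace Summit.HodgeConjecture.HodgeConjecture.Cruxes.H413.K2E1WhittakerLocalUnitValuesUniformU3

variable (L : Type) [Field L] [NumberField L] [IsCMField L] {δ : L} (hcδ : IsCMField.complexConj L δ = -δ) (hδ : δ ≠ 0)
  {d : ↥(maximalRealSubfield L)} (hd : δ * δ = algebraMap ↥(maximalRealSubfield L) L d)

omit [IsCMField L] in
/-- **GALOIS TRANSPORT OF UNITS**: if `ξ` is a unit at every place above `v`, so is `σ ξ` (`|σξ|_{w'} = |ξ|_{σ⁻¹w'}`, ★ `valued_galAdicCompletionMap`).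
[cite: CasselsFrohlichANT1967, Ch. VII §1.1] -/
theorem valued_algEquiv_eq_one (σ : L ≃ₐ[↥(maximalRealSubfield L)] L) (v : HeightOneSpectrum (𝓞 ↥(maximalRealSubfield L))) {ξ : L}
    (hξ : ∀ w' : PlacesOver L v, Valued.v (((ξ : L)) : w'.1.adicCompletion L) = 1) (w' : PlacesOver L v) :
    Valued.v (((σ ξ : L)) : w'.1.adicCompletion L) = 1 := by
  have h : σ • (PlacesOver.galInv σ w').1 = w'.1 := by
    change σ • σ⁻¹ • w'.1 = w'.1
    exact smul_inv_smul σ w'.1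
  rw [← galAdicCompletionMap_coe_algEquiv (σ := σ) (h := h) (x := ξ), valued_galAdicCompletionMap]
  exact hξ _

variable [∀ v : HeightOneSpectrum (𝓞 ↥(maximalRealSubfield L)), MeasurableSpace (v.adicCompletion ↥(maximalRealSubfield L))] [∀ v : HeightOneSpectrum (𝓞 ↥(maximalRealSubfield L)), BorelSpace (v.adicCompletion ↥(maximalRealSubfield L))]
  (νv : ∀ v : HeightOneSpectrum (𝓞 ↥(maximalRealSubfield L)), Measure (v.adicCompletion ↥(maximalRealSubfield L))) [∀ v, (νv v).IsAddHaarMeasure]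

include hd in
/-- **A ξ-INDEPENDENT FINITE EXCEPTIONAL SET FOR THE UNIT VALUES** — ★ F3's `hW` clause (K2E1-p10, `exists_whittaker_letters_cm_three_of`) for every `S₀ ⊇ S_*`:
`∃ S_* : Finset, ∀ v ∉ S_*, ∀ ξ : L, (∀ w' ∣ v, w'.valuation ξ = 1) → ∀ z, 1 < Re z → W_v(ξ,z) = (1 − q_v^{−z})(1 − ε_v q_v^{−z})(1 − ε_v q_v^{−(2z−1)})` (★ B1's token and unit value VERBATIM).
[cite: Rogawski1990, §4.5] [cite: Langlands1971, §3] -/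
theorem exists_finset_forall_localWhittaker_eq_unit :
    ∃ S : Finset (HeightOneSpectrum (𝓞 ↥(maximalRealSubfield L))), ∀ v ∉ S, ∀ ξ : L, (∀ w' : PlacesOver L v, w'.1.valuation L ξ = 1) → ∀ z : ℂ, 1 < z.re →
      ((Measure.pi fun _ : Fin 3 => νv v) (integralBox ↥(maximalRealSubfield L) (Fin 3) v)).toReal⁻¹ •
          ∫ p : Fin 3 → v.adicCompletion ↥(maximalRealSubfield L),
            ((((∏ w' : PlacesOver L v, max 1 (max ((normAbs (w'.1.adicCompletion L) (quadraticLocalEquiv L v (IsCMField.complexConj L) hcδ hδ (p 0, p 1) w') : ℝ≥0) : ℝ)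
          ((normAbs (w'.1.adicCompletion L) ((toLocalRing L v (p 2) * algebraMap L (LocalRing L v) δ -
            toLocalRing L v 2⁻¹ * (quadraticLocalEquiv L v (IsCMField.complexConj L) hcδ hδ (p 0, p 1) *
              conjLocal L (IsCMField.complexConj L) v (quadraticLocalEquiv L v (IsCMField.complexConj L) hcδ hδ (p 0, p 1)))) w') : ℝ≥0) : ℝ))) : ℝ) : ℂ) ^ (-z)) *
              (∏ w' : PlacesOver L v, (adeleAddCharAt L w'.1 (((ξ : L) : w'.1.adicCompletion L) * quadraticLocalEquiv L v (IsCMField.complexConj L) hcδ hδ (p 0, p 1) w') : ℂ))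
            ∂(Measure.pi fun _ : Fin 3 => νv v) =
      (1 - (v.residueCard : ℂ) ^ (-z)) * (1 - (quadraticHeckeCharCM L).valueAtUniformizer v * (v.residueCard : ℂ) ^ (-z)) *
        (1 - (quadraticHeckeCharCM L).valueAtUniformizer v * (v.residueCard : ℂ) ^ (-(2 * z - 1))) := by
  haveI : Algebra.IsQuadraticExtension ↥(maximalRealSubfield L) L := IsCMField.isQuadraticExtension L
  obtain ⟨h1δ, h1δ'⟩ := one_add_delta_ne_zero L hcδ
  have hd0 : d ≠ 0 := by
    rintro rfl
    rw [map_zero, mul_eq_zero, or_self] at hd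
    exact hδ hd
  -- the ξ-independent cofinite conditions
  have e1 : ∀ᶠ v : HeightOneSpectrum (𝓞 ↥(maximalRealSubfield L)) in cofinite, Algebra.IsUnramifiedIn (𝓞 L) v.asIdeal :=
    Filter.eventually_cofinite.2 (Literature.NumberTheory.GaloisRepresentations.finite_setOf_not_isUnramifiedIn ↥(maximalRealSubfield L) L)
  have e2 : ∀ᶠ v : HeightOneSpectrum (𝓞 ↥(maximalRealSubfield L)) in cofinite, Valued.v (2 : v.adicCompletion ↥(maximalRealSubfield L)) = 1 := by
    filter_upwards [eventually_valued_algebraMap_eq_one (E := ↥(maximalRealSubfield L)) (two_ne_zero : (2 : ↥(maximalRealSubfield L)) ≠ 0)] with v hv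
    rwa [map_ofNat] at hv
  have e3 := eventually_forall_placesOver (F := ↥(maximalRealSubfield L)) (E := L) (eventually_valued_algebraMap_eq_one (E := L) hδ)
  have e4 := eventually_valued_algebraMap_eq_one (E := ↥(maximalRealSubfield L)) hd0
  have e5 := eventually_hasConductorExp_zero_charComp L hcδ hδ hd
  have e6 := eventually_forall_placesOver (F := ↥(maximalRealSubfield L)) (E := L) (eventually_valued_algebraMap_eq_one (E := L) h1δ)
  have e7 := eventually_forall_placesOver (F := ↥(maximalRealSubfield L)) (E := L) (eventually_valued_algebraMap_eq_one (E := L) h1δ')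
  obtain ⟨S, hS⟩ := (Filter.eventually_cofinite.1 ((((((e1.and e2).and e3).and e4).and e5).and e6).and e7)).exists_finset_coe
  refine ⟨S, fun v hv ξ hξv z hz => ?_⟩
  have hP := Classical.not_not.1 fun hP => hv (Finset.mem_coe.1 ((Set.ext_iff.1 hS v).2 hP))
  obtain ⟨⟨⟨⟨⟨⟨hv1, hv2⟩, hv3⟩, hv4⟩, hv5⟩, hv6⟩, hv7⟩ := hP
  -- the units `ξ`, `cξ`, `ξ·cξ`, `cξ(1+δ)`, `ξ(1−δ)` above `v`
  have hξ : ∀ w' : PlacesOver L v, Valued.v (((ξ : L)) : w'.1.adicCompletion L) = 1 := fun w' => by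
    rw [HeightOneSpectrum.valuedAdicCompletion_eq_valuation']; exact hξv w'
  have hcξ := valued_algEquiv_eq_one L (IsCMField.complexConj L) v hξ
  have hη : ∀ w' : PlacesOver L v, Valued.v (((IsCMField.complexConj L ξ * (1 + δ) : L)) : w'.1.adicCompletion L) = 1 := fun w' => by
    have := map_mul (algebraMap L (w'.1.adicCompletion L)) (IsCMField.complexConj L ξ) (1 + δ)
    rw [show ((IsCMField.complexConj L ξ * (1 + δ) : L) : w'.1.adicCompletion L) = algebraMap L (w'.1.adicCompletion L) (IsCMField.complexConj L ξ * (1 + δ)) from rfl,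
      this, map_mul]
    exact (congrArg₂ (· * ·) (hcξ w') (hv6 w')).trans (one_mul 1)
  have hcη : ∀ w' : PlacesOver L v, Valued.v (((IsCMField.complexConj L (IsCMField.complexConj L ξ * (1 + δ)) : L)) : w'.1.adicCompletion L) = 1 := fun w' => by
    rw [show IsCMField.complexConj L (IsCMField.complexConj L ξ * (1 + δ)) = ξ * (1 - δ) by
        rw [map_mul, IsCMField.complexConj_apply_apply, map_add, map_one, hcδ, ← sub_eq_add_neg],
      show ((ξ * (1 - δ) : L) : w'.1.adicCompletion L) = algebraMap L (w'.1.adicCompletion L) (ξ * (1 - δ)) from rfl, map_mul, map_mul]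
    exact (congrArg₂ (· * ·) (hξ w') (hv7 w')).trans (one_mul 1)
  set n : ↥(maximalRealSubfield L) := ⟨ξ * IsCMField.complexConj L ξ, mul_complexConj_mem L ξ⟩ with hn_def
  have hn : algebraMap ↥(maximalRealSubfield L) L n = ξ * IsCMField.complexConj L ξ := rfl
  obtain ⟨w⟩ := PlacesOver.nonempty L v
  have hnu : Valued.v ((n : v.adicCompletion ↥(maximalRealSubfield L))) = 1 := by
    rw [← Literature.NumberTheory.NumberFields.valued_toPlace_of_ramificationIdx'_eq_one L v w
      (Literature.NumberTheory.NumberFields.ramificationIdx'_eq_one_of_isUnramifiedIn L v w hv1) (n : v.adicCompletion ↥(maximalRealSubfield L)), toPlace_coe, hn,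
      show ((ξ * IsCMField.complexConj L ξ : L) : w.1.adicCompletion L) = algebraMap L (w.1.adicCompletion L) (ξ * IsCMField.complexConj L ξ) from rfl, map_mul, map_mul]
    exact (congrArg₂ (· * ·) (hξ w) (hcξ w)).trans (one_mul 1)
  by_cases hw : IsCMField.complexConj L • w.1 = w.1
  · -- non-split
    exact localWhittaker_eq_unit_of_nonsplit L hcδ hδ hd v w (νv v) hw hv1 hv2 (hv3 w) hv4 (hv5 w) ξ n hn hnu hη hcη hz
  · -- split
    have hw' := smul_galInv_ne L (IsCMField.complexConj L) hcδ hδ v w hw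
    obtain ⟨a₁, ha₁⟩ := toPlace_surjective ↥(maximalRealSubfield L) L (IsCMField.complexConj L) hcδ hδ hd v w hw ((ξ : L) : w.1.adicCompletion L)
    obtain ⟨a₂, ha₂⟩ := toPlace_surjective ↥(maximalRealSubfield L) L (IsCMField.complexConj L) hcδ hδ hd v (PlacesOver.galInv (IsCMField.complexConj L) w) hw'
      ((ξ : L) : (PlacesOver.galInv (IsCMField.complexConj L) w).1.adicCompletion L)
    have hu₁ : Valued.v a₁ = 1 := by rw [← valued_toPlace_of_split ↥(maximalRealSubfield L) L (IsCMField.complexConj L) v w hw a₁, ha₁]; exact hξ w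
    have hu₂ : Valued.v a₂ = 1 := by
      rw [← valued_toPlace_of_split ↥(maximalRealSubfield L) L (IsCMField.complexConj L) v (PlacesOver.galInv (IsCMField.complexConj L) w) hw' a₂, ha₂]
      exact hξ (PlacesOver.galInv (IsCMField.complexConj L) w)
    have hδ1 : normAbs (v.adicCompletion ↥(maximalRealSubfield L)) (splitSqrt ↥(maximalRealSubfield L) L (IsCMField.complexConj L) hcδ hδ v w) = 1 :=
      normAbs_eq_one_of_valued_eq_one v (by rw [valued_splitSqrt ↥(maximalRealSubfield L) L (IsCMField.complexConj L) hcδ hδ hd v w hw]; exact hv3 w)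
    exact localWhittaker_eq_unit_of_split L hcδ hδ hd v w (νv v) hw hδ1 (normAbs_eq_one_of_valued_eq_one v hv2) (hv5 w)
      (hv5 (PlacesOver.galInv (IsCMField.complexConj L) w)) ξ a₁ a₂ ha₁ ha₂ hu₁ hu₂ hz

end Summit.HodgeConjecture.HodgeConjecture.Cruxes.H413.K2E1WhittakerLocalUnitValuesUniformU3

end
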